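import Mathlib
import Literature.Computability.AlgebraicComplexity.LandsbergRessayreNormalForm

/-!
# Bi-kernel-plane ideal membership of `det (Λ_{i₀} + Z(x))` (crux `BeyondHessianNs`)

Helper file for crux item stmt-ValiantsHypothesis-5641 (`RefutationDegree.BeyondHessianNs`),
stub `stub_biKernelIdeal` of the line `Sketch`.

For the normal-form pencil `A = Λ_{i₀} + Z(x)` over `K[x]` (`x = (x_e)_{e ∈ [n] × [n]}`,
`Z(x) = Σ_e x_e Z_e`, `Λ_{i₀} = lamMatrix K i₀` the identity matrix with the diagonal entry
`(i₀, i₀)` replaced by `0`), write `L = Z(x)_{i₀ i₀}`, `R_j = Z(x)_{i₀ j}` (row forms) and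
`C_i = Z(x)_{i i₀}` (column forms). Then

  `det A ∈ (L) + (R_j : j) · (C_i : i)`   (ideals of `K[x]`),

so `det A` vanishes on the two "kernel planes" `{L = 0, C = 0}` and `{L = 0, R = 0}`.

Proof. A general fact about determinants (`det_mem_span_sup_span_mul_span`): for every square
matrix `M` over a commutative ring and every index `i₀`,
`det M ∈ (M i₀ i₀) + (M i₀ j : j) · (M i i₀ : i)`. Indeed, in the permutation expansion
`det M = Σ_σ ε(σ) Π_i M (σ i) i` the factor `i = i₀` of each product is `M (σ i₀) i₀`; if
`σ i₀ = i₀` this is `M i₀ i₀`, and otherwise the distinct factor `i = σ⁻¹ i₀` is `M i₀ (σ⁻¹ i₀)`, so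
the product is a multiple of `M i₀ (σ⁻¹ i₀) * M (σ i₀) i₀`. Since row `i₀` and column `i₀` of
`Λ_{i₀}` vanish, the row-`i₀` and column-`i₀` entries of `A` are exactly the forms `R_j`, `C_i`
(and `A i₀ i₀ = L`), which gives the statement. No Laplace expansion is needed.
-/

noncomputable section

-- single-conjunct layout: Sub = Summit, duplicated namespace component intended
set_option linter.dupNamespace false

namespace Summit.ValiantsHypothesis.ValiantsHypothesis.Theorems.RefutationDegreeBeyondHessianNs

open Matrix MvPolynomial
open Literature.Computability.AlgebraicComplexity

/-- For a square matrix `M` over a commutative ring and an index `i₀`, the determinant lies in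
the ideal `(M i₀ i₀) + (M i₀ j : j) · (M i i₀ : i)` generated by the diagonal entry at `i₀` and
the products (row-`i₀` entry) × (column-`i₀` entry): every product `Π_i M (σ i) i` of the
permutation expansion contains the factor `M (σ i₀) i₀`, and, when `σ i₀ ≠ i₀`, also the distinct
factor `M i₀ (σ⁻¹ i₀)`. [folklore] -/
theorem det_mem_span_sup_span_mul_span {S : Type*} [CommRing S] {ι : Type*} [DecidableEq ι]
    [Fintype ι] (M : Matrix ι ι S) (i₀ : ι) :
    M.det ∈ Ideal.span {M i₀ i₀} ⊔
      Ideal.span (Set.range fun j => M i₀ j) * Ideal.span (Set.range fun i => M i i₀) := by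
  rw [Matrix.det_apply']
  refine Ideal.sum_mem _ fun σ _ => Ideal.mul_mem_left _ _ ?_
  have h1 : ∏ i, M (σ i) i = M (σ i₀) i₀ * ∏ i ∈ Finset.univ.erase i₀, M (σ i) i :=
    (Finset.mul_prod_erase _ _ (Finset.mem_univ i₀)).symm
  by_cases h : σ i₀ = i₀
  · rw [h1, h]
    exact Ideal.mem_sup_left (Ideal.mul_mem_right _ _ (Ideal.subset_span rfl))
  · have hj : σ.symm i₀ ≠ i₀ := fun h' => h (σ.symm_apply_eq.1 h').symm
    have h2 : ∏ i ∈ Finset.univ.erase i₀, M (σ i) i = M (σ (σ.symm i₀)) (σ.symm i₀) *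
        ∏ i ∈ (Finset.univ.erase i₀).erase (σ.symm i₀), M (σ i) i :=
      (Finset.mul_prod_erase _ _ (Finset.mem_erase.2 ⟨hj, Finset.mem_univ _⟩)).symm
    rw [h1, h2, Equiv.apply_symm_apply, ← mul_assoc, mul_comm (M (σ i₀) i₀)]
    exact Ideal.mem_sup_right (Ideal.mul_mem_right _ _
      (Ideal.mul_mem_mul (Ideal.subset_span ⟨σ.symm i₀, rfl⟩) (Ideal.subset_span ⟨σ i₀, rfl⟩)))

/-- Entries of the normal-form pencil `Λ_{i₀} + Σ_e x_e Z_e`: the `(i, j)` entry is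
`C (Λ_{i₀})_{i j} + Σ_e C (Z_e)_{i j} * x_e`. [folklore] -/
theorem lamMatrix_pencil_apply (K : Type) [CommRing K] (n m : ℕ) (i₀ : Fin m)
    (Z : Fin n × Fin n → Matrix (Fin m) (Fin m) K) (i j : Fin m) :
    ((lamMatrix K i₀).map MvPolynomial.C + ∑ e : Fin n × Fin n,
        (MvPolynomial.X e : MvPolynomial (Fin n × Fin n) K) •
          (Z e).map (MvPolynomial.C : K →+* MvPolynomial (Fin n × Fin n) K) :
        Matrix (Fin m) (Fin m) (MvPolynomial (Fin n × Fin n) K)) i j =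
      C (lamMatrix K i₀ i j) + ∑ e : Fin n × Fin n, C ((Z e) i j) * X e := by
  simp only [Matrix.add_apply, Matrix.map_apply, Matrix.sum_apply, Matrix.smul_apply,
    smul_eq_mul, mul_comm (X _)]

/-- Row `i₀` of the normal-form pencil consists of the row forms `R_j = Σ_e C (Z_e)_{i₀ j} * x_e`
(row `i₀` of `Λ_{i₀}` vanishes). [folklore] -/
theorem lamMatrix_pencil_apply_row (K : Type) [CommRing K] (n m : ℕ) (i₀ : Fin m)
    (Z : Fin n × Fin n → Matrix (Fin m) (Fin m) K) (j : Fin m) :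
    ((lamMatrix K i₀).map MvPolynomial.C + ∑ e : Fin n × Fin n,
        (MvPolynomial.X e : MvPolynomial (Fin n × Fin n) K) •
          (Z e).map (MvPolynomial.C : K →+* MvPolynomial (Fin n × Fin n) K) :
        Matrix (Fin m) (Fin m) (MvPolynomial (Fin n × Fin n) K)) i₀ j =
      ∑ e : Fin n × Fin n, C ((Z e) i₀ j) * X e := by
  rw [lamMatrix_pencil_apply, lamMatrix_apply]
  simp

/-- Column `i₀` of the normal-form pencil consists of the column forms
`C_i = Σ_e C (Z_e)_{i i₀} * x_e` (column `i₀` of `Λ_{i₀}` vanishes). [folklore] -/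
theorem lamMatrix_pencil_apply_col (K : Type) [CommRing K] (n m : ℕ) (i₀ : Fin m)
    (Z : Fin n × Fin n → Matrix (Fin m) (Fin m) K) (i : Fin m) :
    ((lamMatrix K i₀).map MvPolynomial.C + ∑ e : Fin n × Fin n,
        (MvPolynomial.X e : MvPolynomial (Fin n × Fin n) K) •
          (Z e).map (MvPolynomial.C : K →+* MvPolynomial (Fin n × Fin n) K) :
        Matrix (Fin m) (Fin m) (MvPolynomial (Fin n × Fin n) K)) i i₀ =
      ∑ e : Fin n × Fin n, C ((Z e) i i₀) * X e := by
  rw [lamMatrix_pencil_apply, lamMatrix_apply]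
  by_cases h : i = i₀ <;> simp [h]

/-- **Bi-kernel-plane structure of `det (Λ_{i₀} + Z(x))`.** With `L = Z(x)_{i₀ i₀}`, row forms
`R_j = Z(x)_{i₀ j}` and column forms `C_i = Z(x)_{i i₀}` (`Z(x) = Σ_e x_e Z_e`), the determinant
of the normal-form pencil lies in the ideal `(L) + (R_j : j) · (C_i : i)` of `K[x]`; in
particular it vanishes on the kernel planes `{L = 0, C = 0}` and `{L = 0, R = 0}`. [folklore] -/
theorem stub_biKernelIdeal : ∀ (K : Type) [CommRing K] (n m : ℕ) (i₀ : Fin m) (Z : Fin n × Fin n → Matrix (Fin m) (Fin m) K), ((Literature.Computability.AlgebraicComplexity.lamMatrix K i₀).map MvPolynomial.C + ∑ e : Fin n × Fin n, (MvPolynomial.X e : MvPolynomial (Fin n × Fin n) K) • (Z e).map (MvPolynomial.C : K →+* MvPolynomial (Fin n × Fin n) K) : Matrix (Fin m) (Fin m) (MvPolynomial (Fin n × Fin n) K)).det ∈ Ideal.span {∑ e : Fin n × Fin n, MvPolynomial.C ((Z e) i₀ i₀) * MvPolynomial.X e} ⊔ Ideal.span (Set.range fun j : Fin m => ∑ e :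 Fin n × Fin n, MvPolynomial.C ((Z e) i₀ j) * MvPolynomial.X e) * Ideal.span (Set.range fun i : Fin m => ∑ e : Fin n × Fin n, MvPolynomial.C ((Z e) i i₀) * MvPolynomial.X e) := by
  intro K _ n m i₀ Z
  have key := det_mem_span_sup_span_mul_span ((lamMatrix K i₀).map MvPolynomial.C +
    ∑ e : Fin n × Fin n, (MvPolynomial.X e : MvPolynomial (Fin n × Fin n) K) •
      (Z e).map (MvPolynomial.C : K →+* MvPolynomial (Fin n × Fin n) K) :
        Matrix (Fin m) (Fin m) (MvPolynomial (Fin n × Fin n) K)) i₀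
  simp only [lamMatrix_pencil_apply_row, lamMatrix_pencil_apply_col] at key
  exact key

end Summit.ValiantsHypothesis.ValiantsHypothesis.Theorems.RefutationDegreeBeyondHessianNs
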